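import Literature.MathematicalPhysics.QuantumFieldTheory.Balaban1983to89.B8LeafKnit
import Literature.MathematicalPhysics.QuantumFieldTheory.Balaban1983to89.B8Thm8Surviving

/-!
# `Balaban1983to89.B8LeafKnitRS` — T. Bałaban, *Spaces of regular gauge field configurations on a lattice and gauge fixing
# conditions*, Commun. Math. Phys. **99** (1985) 75–102 [Balaban1985RegularSpaces] = cell paper B8, DAG node **N05**: the RE-TYPED
# faithful leaf `B8LeafRS` (conjunct `t8 :=` Theorem 8 p. 101 in its SURVIVING form `B8Thm8Surviving.Thm8SurvivingAt 1`, GAPS G-B8-13),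
# the ADDITIVE re-bound upstream `Upstream.ofPrintedAllXPNS`, OLD ⇒ NEW, and the N05 knit re-run on it — the `B4LeafNN` ∕
# `Upstream.ofPrintedAllXPN` pattern of `DagDischargedII` (cell GAPS G-ref1-32) applied to leaf `b8`

statement-level skeleton of published theorems with citation tags; proofs where landed; nothing here is a claim about the Yang–Mills mass gap

CITATION HEADER (lean-in-tree rule).  Cell `pub-ymgap` (YM-PLAN Track A, HUMAN RULING D-0062), seat `pub-ymgap-dag-n05-a` = the
KNIT-BY-NAME seat of node N05 (`Dag.B8_main ℓ := ℓ.b5 → ℓ.b6 → ℓ.b7 → ℓ.b9 → ℓ.b8`, `Dag.lean` :198; leaf `b8 ↦ DagBinding.B8LeafR`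
:845; knit of record `B8LeafKnit`, p408782).  PDF held: `paper:balaban1985-cmp99-regular-spaces-gauge-fixing` (journal page = PDF page
+ 74); the printed statements are quoted VERBATIM in the docstrings of the typed leaves named here (`B8.Lemma1Printed` … `B8.Prop6Printed`,
`B8SectGH.Prop7PrintedR`, `B8Thm8Surviving.Thm8SurvivingAt`) and are not re-quoted.  On the cell bus: the seat's `B8-RETYPE-PROPOSAL.md`
(2026-08-25), the DAG-typing seat's answer (b2b-balaban-t4-dagwriter g79, INBOX l.9141 (β): *«from the DAG-typing side NO OBJECTION —
`ℓ.b8` is an ABSTRACT leaf read only as a HYPOTHESIS by `Dag.B11_main`∕`B10_main`∕`B12_main`∕`B13∕B14_main`∕`B15_main` … and no typed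
consumer destructures `t8` today, so `B8LeafRS` (t8 := Thm8SurvivingAt 1) is knit-safe; land it ADDITIVELY … (v5: `B8LeafRS` +
`Upstream.ofPrinted…RS` + OLD ⇒ NEW `b8LeafRS_of_b8LeafR`, v1–v4 untouched)»*), and the discharge referee's PASS condition for N05
(ref-A g2, STATUS l.4101 (4)(i): «… or conjunct t8 is first re-typed to the surviving form»).

WHY.  The bound leaf `DagBinding.B8LeafR` has conjunct `t8 : B8SectGH.Thm8PrintedAt 1 B₁ B₂ fam` — Theorem 8 AS TYPED — which is
KERNEL-REFUTED for every `B₁, B₂` on print's ADMITTED flat abelian torus instances (`B8Thm8FlatAbelianFamily.not_thm8PrintedAt`; U(1):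
`B8Thm8U1Family`), so that over any gauge-fixing family containing those members the leaf is FALSE and N05 holds ex falso only
(`B8LeafKnit.not_b8LeafR_of_flat_subfamily`, `b8_main_iff_inEdge_fails_of_flat_subfamily`).  `B8Thm8Surviving.Thm8SurvivingAt γ` types what
survives (print's sentence at one γ with `InR`, print's uniqueness clause, and only the two refuted members of (1.36)∕(1.39) made conditional on
the inspected size `|D^η_{U₀}f|₍₋₃₎ < γ(α₀ + α₁)`), and the seat's companion file `B8LeafModelV1Thm8` (`thm8SurvivingAt_v1`, filed after
`B8LeafModelV1`) PROVES it on the honest `k`-level torus model family at `U₀ = 1` for every γ ≥ 0.  This module makes the re-typed leaf AVAILABLE to the binding owner, ADDITIVELY: nothing in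
`DagBinding` ∕ `DagDischargedII` ∕ `Node00.*` is edited, no existing binding is re-pointed, and every consumer that reads `ℓ.b8` as a
hypothesis is unaffected.  Whether NODE 00 points a Stage binding at `Upstream.ofPrintedAllXPNS` (and how it rules conjunct `p7`, question
N0-6) is the chair's ∕ node00-def's decision, not this file's.

WHAT THIS FILE TYPES AND PROVES (0 sorry; axioms standard; 1 structure + 2 plumbing defs; theorems otherwise).
§1 PLUMBING (Prop-generic, the twin of `DagDischargedII`'s `Upstream.withB4`): `Upstream.withB8 u b8` (re-bind ONE leaf) and
   `withB8_leaves` (`rfl` ×12).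
§2 THE RE-TYPED LEAF `B8LeafRS d L C₂ B′₁ B′₀ B₁ B₂ c₁ inp B₀β loc fam lan cub toAxial` — `DagBinding.B8LeafR`'s nine conjuncts with the SAME
   parameters and carriers, `l1 t2 p3 t4 p5e p5u p6 p7` VERBATIM (by name: `B8.Lemma1Printed`, `B8.Thm2Printed`, `B8.Prop3Printed`,
   `B8.Thm4Printed`, `B8.Prop5Exists`, `B8.Prop5Unique`, `B8.Prop6Printed`, `B8SectGH.Prop7PrintedR`) and
   `t8 := B8Thm8Surviving.Thm8SurvivingAt 1 B₁ B₂ fam`; `b8LeafRS_of_b8LeafR` — OLD ⇒ NEW under the displayed carrier law (1.36) ⊂ (1.62)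
   (`B8Thm8Surviving.thm8SurvivingAt_of_printedAt`), NEVER conversely; `b8LeafRS_iff` bookkeeping.
§3 THE RE-BOUND UPSTREAM `Upstream.ofPrintedAllXPNS X Y Z V W := (Upstream.ofPrintedAllXPN X Y Z V W).withB8 (B8LeafRS … X.fam8R …)` — the
   N-binding of `DagDischargedII` (B4 leaf in NN form, B6 leaf in parameter form) with `b8` re-typed; `ofPrintedAllXPNS_leaves` (`rfl` ×12:
   every other leaf IS the N-binding's), `ofPrintedAllXPNS_b8_iff` (`Iff.rfl`), `ofPrintedAllXPNS_b8_of_ofPrintedAllXPN` (OLD ⇒ NEW at the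
   binding, under the law), `b8_main_iff_of_upS` (N05 at a run so bound ↔ `b5 → b6 → b7 → b9 → B8LeafRS …`).
§4 THE KNIT RE-RUN: `b8LeafRS_knit` — the re-typed leaf from EIGHT named printed statements with Theorem 2 DERIVED (`B8.thm2_of_thm4_prop3`,
   p. 88) exactly as `B8LeafKnit.b8LeafR_knit`, the only change being `t8`'s type; `b8LeafRS_knit_blockPairNA` (Lemma 1 consumed on the
   non-abelian block-pair carriers); node level `b8_main_of_upS`, `b8_main_of_upS_knit`.
§5 HAZARDS REVISITED: (a) the flat-sub-family refutation of §4 of `B8LeafKnit` does NOT transfer to `B8LeafRS` — its mechanism is the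
   `∇`-member of (1.36) for `|f|₍₋₂₎`-sources, which `Thm8SurvivingAt` asserts only under `fGrad`; no theorem is claimed here about the flat
   family and the RS leaf (positive evidence: the companion file's `thm8SurvivingAt_v1` on the V1 model family); (b) the Prop-7 half-space hazard
   (NODE 00 question N0-6) is UNCHANGED: `not_b8LeafRS_halfspace` (conjunct `p7` is print's faithful `Prop7PrintedR`, refuted on r05's
   half-space packaging `B8Prop7HalfSpace.halfspaceGF 4 3 0 ℂ`; it holds on print's admitted family, `B8Prop7AdmittedFamily`).

HONEST SCOPE ∕ NOT CLAIMED.  (i) TYPING + BOOKKEEPING ONLY, count-neutral: no conjunct is proved here beyond what the imports prove (Lemma 1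
on the block-pair carriers); `p3 t4 p5e p5u p6 p7 t8` stay HYPOTHESES of the knit; NOT a discharge of N05.  (ii) ADDITIVE: `B8LeafR`,
`Upstream.ofPrintedR∕Full∕All∕AllX∕AllXP∕AllXPN` and every `Node00` Stage binding are untouched; NODE 00's world of record still binds
`B8LeafR` until node00-def ∕ the chair say otherwise — this file only makes the alternative available with its OLD ⇒ NEW certificate.
(iii) The surviving form asks LESS than print's sentence as typed (two members of (1.36)∕(1.39) conditional); that this is the content the
series' consumer of Theorem 8 uses ([Balaban1985Variational] (125) p. 297) is the cell's reading (pub-balaban GAPS G-B11-E3a), to be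
confirmed by the B11∕B10 dischargers at discharge time (dagwriter's caveat, l.9141).  (iv) Conjunct `p7` keeps print's faithful form; its
N0-6 ruling (admitted families only, or `B8Ineq145.Prop7RepairedC`) is NOT pre-empted.  (v) One finite four-torus programme at fixed ε,
Bałaban AS PRINTED with locators; nothing continuum ∕ ℝ⁴ ∕ OS ∕ mass gap ∕ Clay.
-/

namespace Literature.MathematicalPhysics.QuantumFieldTheory.Balaban1983to89.B8LeafKnitRS

open DagBinding DagDischarged DagDischargedII B8LeafKnit

/-! ## §1 Plumbing: re-binding the `b8` leaf of an upstream bundle -/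

section Plumbing

/-- Re-binding ONE leaf: the upstream `u` with its `b8` slot replaced by the proposition `b8` (all other leaves unchanged, `rfl`).
Prop-generic plumbing, the twin of `DagDischargedII`'s `Upstream.withB4` and `DagBinding.Upstream.withB6`. [folklore] -/
def _root_.Literature.MathematicalPhysics.QuantumFieldTheory.Balaban1983to89.DagBinding.Upstream.withB8
    (u : Upstream) (b8 : Prop) : Upstream :=
  { u with b8 := b8 }

/-- Bookkeeping (`rfl`): the re-bound leaf and the untouched ones (the leaves of the series' DAG, [Balaban1989LargeFieldII] Thm 1 inputs,
re-bound at `b8` = [Balaban1985RegularSpaces] Lemma 1 – Thm 8). [cite: Balaban1985RegularSpaces, Lemma 1 – Thm 8 pp.79–101 (leaf re-binding; bookkeeping)] -/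
theorem withB8_leaves (u : Upstream) (b8 : Prop) :
    (u.withB8 b8).b8 = b8 ∧ (u.withB8 b8).b4 = u.b4 ∧ (u.withB8 b8).b5 = u.b5 ∧ (u.withB8 b8).b6 = u.b6 ∧
    (u.withB8 b8).b7 = u.b7 ∧ (u.withB8 b8).b9 = u.b9 ∧ (u.withB8 b8).b10 = u.b10 ∧ (u.withB8 b8).b11 = u.b11 ∧
    (u.withB8 b8).b12 = u.b12 ∧ (u.withB8 b8).b13 = u.b13 ∧ (u.withB8 b8).rOperation = u.rOperation ∧
    (u.withB8 b8).rBasicStep = u.rBasicStep :=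
  ⟨rfl, rfl, rfl, rfl, rfl, rfl, rfl, rfl, rfl, rfl, rfl, rfl⟩

end Plumbing

/-! ## §2 The re-typed faithful leaf `B8LeafRS` and OLD ⇒ NEW -/

section Leaf

/-- **The faithful B8 leaf with Theorem 8 in its SURVIVING form**: `DagBinding.B8LeafR` (Lemma 1 p. 79, Thm 2 p. 83, Prop 3 p. 87, Thm 4
p. 88, Prop 5 p. 94 both halves, Prop 6 p. 99, Prop 7 p. 100 faithful form — BY NAME, unchanged, same parameters and carriers) with
conjunct `t8 := B8Thm8Surviving.Thm8SurvivingAt 1 B₁ B₂ fam` (Theorem 8 p. 101 at print's «e.g. γ = 1»: print's sentence with the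
membership binder and print's uniqueness clause, the `∇`-∕Hölder members of (1.36) and (1.39) asserted only under the inspected source size
— cell objection GAPS G-B8-13) in place of `B8SectGH.Thm8PrintedAt 1 B₁ B₂ fam`.  Deliberately absent, as in `B8LeafR`: (1.147) (printed as
unproved, G-B8-09). [cite: Balaban1985RegularSpaces, Lemma 1 – Thm 8 pp.79–101; Thm 8 (1.146) p.101 in the surviving form (GAPS G-B8-13)] -/
structure B8LeafRS {I₁ I₂ I₃ I₄ : Type} (d : ℕ) (L C₂ B₁' B₀' B₁ B₂ c₁ : ℝ) (inp : B8.B9Inputs) (B₀β : ℝ)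
    (loc : I₁ → B8.LocalData) (fam : I₂ → B8SectGH.GFData3) (lan : I₃ → B8.LandauData)
    (cub : I₄ → B8.CubeData) (toAxial : ∀ i, (fam i).Cfg → (fam i).Pert → (fam i).Pert) : Prop where
  l1 : B8.Lemma1Printed d loc
  t2 : B8.Thm2Printed (fun i => (fam i).toGFData)
  p3 : B8.Prop3Printed d L C₂ inp B₀β (fun i => (fam i).toGFData2)
  t4 : B8.Thm4Printed B₁' (fun i => (fam i).toGFData)
  p5e : B8.Prop5Exists B₀' B₁ lan
  p5u : B8.Prop5Unique lan
  p6 : B8.Prop6Printed d L B₁ c₁ cub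
  p7 : B8SectGH.Prop7PrintedR fam toAxial
  t8 : B8Thm8Surviving.Thm8SurvivingAt 1 B₁ B₂ fam

variable {I₁ I₂ I₃ I₄ : Type} {d : ℕ} {L C₂ B₁' B₀' B₁ B₂ c₁ : ℝ} {inp : B8.B9Inputs} {B₀β : ℝ}
  {loc : I₁ → B8.LocalData} {fam : I₂ → B8SectGH.GFData3} {lan : I₃ → B8.LandauData} {cub : I₄ → B8.CubeData}
  {toAxial : ∀ i, (fam i).Cfg → (fam i).Pert → (fam i).Pert}

/-- **OLD ⇒ NEW** (the G-ref1-32 ∕ `B4LeafNN` pattern «typed ⇒ surviving, never conversely»): the bound leaf `DagBinding.B8LeafR` implies the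
re-typed leaf, conjuncts `l1`–`p7` verbatim and `t8` by `B8Thm8Surviving.thm8SurvivingAt_of_printedAt` under the one displayed carrier law
(1.36) ⊂ (1.62) (`rfl`-true in any honest instance).  The converse is NOT claimed — it is the refuted content. [cite: Balaban1985RegularSpaces, Thm 8 p.101 + (1.36) p.82 + (1.62) p.87 (bookkeeping)] -/
theorem b8LeafRS_of_b8LeafR
    (h136_162 : ∀ i b b₂ s (U₀ : (fam i).Cfg) (U₁ : (fam i).Pert), (fam i).C136 b b₂ s U₀ U₁ → (fam i).C162 b s U₀ U₁)
    (h : B8LeafR d L C₂ B₁' B₀' B₁ B₂ c₁ inp B₀β loc fam lan cub toAxial) :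
    B8LeafRS d L C₂ B₁' B₀' B₁ B₂ c₁ inp B₀β loc fam lan cub toAxial where
  l1 := h.l1
  t2 := h.t2
  p3 := h.p3
  t4 := h.t4
  p5e := h.p5e
  p5u := h.p5u
  p6 := h.p6
  p7 := h.p7
  t8 := B8Thm8Surviving.thm8SurvivingAt_of_printedAt 1 B₁ B₂ fam h136_162 h.t8

variable (d L C₂ B₁' B₀' B₁ B₂ c₁ inp B₀β loc fam lan cub toAxial) in
/-- The re-typed leaf unfolded (`Iff` by constructor∕projections): nine named printed statements. [cite: Balaban1985RegularSpaces, Lemma 1 – Thm 8 pp.79–101 (bookkeeping)] -/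
theorem b8LeafRS_iff :
    B8LeafRS d L C₂ B₁' B₀' B₁ B₂ c₁ inp B₀β loc fam lan cub toAxial ↔
      B8.Lemma1Printed d loc ∧ B8.Thm2Printed (fun i => (fam i).toGFData) ∧
      B8.Prop3Printed d L C₂ inp B₀β (fun i => (fam i).toGFData2) ∧ B8.Thm4Printed B₁' (fun i => (fam i).toGFData) ∧
      B8.Prop5Exists B₀' B₁ lan ∧ B8.Prop5Unique lan ∧ B8.Prop6Printed d L B₁ c₁ cub ∧ B8SectGH.Prop7PrintedR fam toAxial ∧
      B8Thm8Surviving.Thm8SurvivingAt 1 B₁ B₂ fam :=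
  ⟨fun h => ⟨h.l1, h.t2, h.p3, h.t4, h.p5e, h.p5u, h.p6, h.p7, h.t8⟩,
    fun ⟨l1, t2, p3, t4, p5e, p5u, p6, p7, t8⟩ => ⟨l1, t2, p3, t4, p5e, p5u, p6, p7, t8⟩⟩

end Leaf

/-! ## §3 The re-bound upstream `Upstream.ofPrintedAllXPNS` — the N-binding with `b8` re-typed -/

section Binding

/-- **The N-binding of `DagDischargedII` with the B8 leaf RE-TYPED**: `Upstream.ofPrintedAllXPN X Y Z V W` (B4 leaf in NN form, B6 leaf in
parameter form, every other leaf as in `Upstream.ofPrintedAllX`) with `b8 := B8LeafRS … X.fam8R …` over the bundle's own B8 carrier group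
and constants. ADDITIVE: `ofPrintedAllXPN` itself is untouched. [cite: Balaban1985RegularSpaces, Lemma 1 – Thm 8 pp.79–101 (the re-typed bound leaf; bookkeeping)] -/
def _root_.Literature.MathematicalPhysics.QuantumFieldTheory.Balaban1983to89.DagBinding.Upstream.ofPrintedAllXPNS
    (X : PrintedCarriersR) (Y : PrintedCarriers9X) (Z : PrintedCarriers11) (V : PrintedCarriers14R) (W : PrintedCarriers15) :
    Upstream :=
  (Upstream.ofPrintedAllXPN X Y Z V W).withB8
    (B8LeafRS X.d8 X.L8 X.C₂ X.B₁' X.B₀' X.B₁ X.B₂ X.c₁ X.inp8 X.B₀β X.loc8 X.fam8R X.lan8 X.cub8 X.toAxial8)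

variable (X : PrintedCarriersR) (Y : PrintedCarriers9X) (Z : PrintedCarriers11) (V : PrintedCarriers14R) (W : PrintedCarriers15)

/-- Bookkeeping (`rfl`): the leaves of the S-binding — `b8` is the re-typed leaf, EVERY other leaf is the N-binding's.
[cite: Balaban1985RegularSpaces, Lemma 1 – Thm 8 pp.79–101 (the re-typed bound leaf; bookkeeping)] -/
theorem ofPrintedAllXPNS_leaves :
    (Upstream.ofPrintedAllXPNS X Y Z V W).b8 =
      B8LeafRS X.d8 X.L8 X.C₂ X.B₁' X.B₀' X.B₁ X.B₂ X.c₁ X.inp8 X.B₀β X.loc8 X.fam8R X.lan8 X.cub8 X.toAxial8 ∧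
    (Upstream.ofPrintedAllXPNS X Y Z V W).b4 = (Upstream.ofPrintedAllXPN X Y Z V W).b4 ∧
    (Upstream.ofPrintedAllXPNS X Y Z V W).b5 = (Upstream.ofPrintedAllXPN X Y Z V W).b5 ∧
    (Upstream.ofPrintedAllXPNS X Y Z V W).b6 = (Upstream.ofPrintedAllXPN X Y Z V W).b6 ∧
    (Upstream.ofPrintedAllXPNS X Y Z V W).b7 = (Upstream.ofPrintedAllXPN X Y Z V W).b7 ∧
    (Upstream.ofPrintedAllXPNS X Y Z V W).b9 = (Upstream.ofPrintedAllXPN X Y Z V W).b9 ∧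
    (Upstream.ofPrintedAllXPNS X Y Z V W).b10 = (Upstream.ofPrintedAllXPN X Y Z V W).b10 ∧
    (Upstream.ofPrintedAllXPNS X Y Z V W).b11 = (Upstream.ofPrintedAllXPN X Y Z V W).b11 ∧
    (Upstream.ofPrintedAllXPNS X Y Z V W).b12 = (Upstream.ofPrintedAllXPN X Y Z V W).b12 ∧
    (Upstream.ofPrintedAllXPNS X Y Z V W).b13 = (Upstream.ofPrintedAllXPN X Y Z V W).b13 ∧
    (Upstream.ofPrintedAllXPNS X Y Z V W).rOperation = (Upstream.ofPrintedAllXPN X Y Z V W).rOperation ∧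
    (Upstream.ofPrintedAllXPNS X Y Z V W).rBasicStep = (Upstream.ofPrintedAllXPN X Y Z V W).rBasicStep :=
  ⟨rfl, rfl, rfl, rfl, rfl, rfl, rfl, rfl, rfl, rfl, rfl, rfl⟩

/-- The `b8` leaf of the S-binding unfolded (`Iff.rfl`): the nine printed statements of [Balaban1985RegularSpaces] with Theorem 8 in its
surviving form. [cite: Balaban1985RegularSpaces, Lemma 1 – Thm 8 pp.79–101 (the re-typed bound leaf; bookkeeping)] -/
theorem ofPrintedAllXPNS_b8_iff :
    (Upstream.ofPrintedAllXPNS X Y Z V W).b8 ↔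
      B8LeafRS X.d8 X.L8 X.C₂ X.B₁' X.B₀' X.B₁ X.B₂ X.c₁ X.inp8 X.B₀β X.loc8 X.fam8R X.lan8 X.cub8 X.toAxial8 :=
  Iff.rfl

/-- **OLD ⇒ NEW at the binding**: the N-binding's `b8` leaf (= `B8LeafR` over `X`'s group, `B8LeafKnit.ofPrintedAllXPN_b8_iff`) implies the
S-binding's, under the carrier law (1.36) ⊂ (1.62) for `X.fam8R` — never conversely. [cite: Balaban1985RegularSpaces, Thm 8 p.101 (bookkeeping)] -/
theorem ofPrintedAllXPNS_b8_of_ofPrintedAllXPN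
    (h136_162 : ∀ i b b₂ s (U₀ : (X.fam8R i).Cfg) (U₁ : (X.fam8R i).Pert), (X.fam8R i).C136 b b₂ s U₀ U₁ → (X.fam8R i).C162 b s U₀ U₁)
    (h : (Upstream.ofPrintedAllXPN X Y Z V W).b8) : (Upstream.ofPrintedAllXPNS X Y Z V W).b8 :=
  b8LeafRS_of_b8LeafR h136_162 ((ofPrintedAllXPN_b8_iff X Y Z V W).mp h)

variable (w : WorldP) (P : B12.RunParams) {X Y Z V W}

/-- **N05 at a run bound by the S-binding IS «b5 → b6 → b7 → b9 → B8LeafRS …»** over the bundle's B8 group (unfolding `Dag.B8_main` and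
the binding). [cite: Balaban1985RegularSpaces, Lemma 1 – Thm 8 pp.79–101 (node bookkeeping)] -/
theorem b8_main_iff_of_upS (hup : w.up P = Upstream.ofPrintedAllXPNS X Y Z V W) :
    Dag.B8_main (leavesP w P) ↔
      ((Upstream.ofPrintedAllXPN X Y Z V W).b5 → (Upstream.ofPrintedAllXPN X Y Z V W).b6 →
        (Upstream.ofPrintedAllXPN X Y Z V W).b7 → (Upstream.ofPrintedAllXPN X Y Z V W).b9 →
          B8LeafRS X.d8 X.L8 X.C₂ X.B₁' X.B₀' X.B₁ X.B₂ X.c₁ X.inp8 X.B₀β X.loc8 X.fam8R X.lan8 X.cub8 X.toAxial8) := by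
  show ((w.up P).b5 → (w.up P).b6 → (w.up P).b7 → (w.up P).b9 → (w.up P).b8) ↔ _
  rw [hup]
  exact Iff.rfl

end Binding

/-! ## §4 The N05 knit re-run on the re-typed leaf -/

section Knit

variable {I₁ I₂ I₃ I₄ : Type} {d : ℕ} {L C₂ B₁' B₀' B₁ B₂ c₁ : ℝ} {inp : B8.B9Inputs} {B₀β : ℝ}
  {loc : I₁ → B8.LocalData} {fam : I₂ → B8SectGH.GFData3} {lan : I₃ → B8.LandauData} {cub : I₄ → B8.CubeData}
  {toAxial : ∀ i, (fam i).Cfg → (fam i).Pert → (fam i).Pert}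

/-- **THE KNIT of the re-typed leaf `B8LeafRS`** from EIGHT of its nine printed statements — `B8LeafKnit.b8LeafR_knit` with the single change
that `t8` is Theorem 8 in its SURVIVING form: Lemma 1 p. 79 (`l1`), Prop 3 p. 87 (`p3`), Thm 4 p. 88 (`t4`), Prop 5 p. 94 (`p5e`, `p5u`),
Prop 6 p. 99 (`p6`), Prop 7 p. 100 faithful (`p7`), Thm 8 p. 101 surviving at γ = 1 (`t8`); THEOREM 2 p. 83 DERIVED by `B8.thm2_of_thm4_prop3`
(print p. 88 «Thus Theorem 4 implies Theorem 2») from `t4`, `p3`, the threshold `c₀` of (1.65) and the six displayed carrier laws, under the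
constant side conditions `1 ≤ d`, `0 < L`, `0 < B₀(β₀)`, `0 ≤ C₂`, `5dLB₀ ≤ B′₁`.  The seven remaining printed statements are HYPOTHESES —
the discharge-shaped file of the node for the re-typed leaf, not a discharge.
[cite: Balaban1985RegularSpaces, Lemma 1 p.79, Thm 2 p.83, Prop. 3 p.87, Thm 4 p.88 with «Thm 4 ⇒ Thm 2» p.88, Prop. 5 p.94, Prop. 6 p.99, Prop. 7 p.100, Thm 8 p.101 (surviving form)] -/
theorem b8LeafRS_knit (hd : 1 ≤ d) (hL : 0 < L) (hB₀β : 0 < B₀β) (hC₂ : 0 ≤ C₂) (hB₁' : 5 * d * L * inp.B₀ ≤ B₁')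
    (l1 : B8.Lemma1Printed d loc)
    (p3 : B8.Prop3Printed d L C₂ inp B₀β (fun i => (fam i).toGFData2))
    (t4 : B8.Thm4Printed B₁' (fun i => (fam i).toGFData))
    (p5e : B8.Prop5Exists B₀' B₁ lan) (p5u : B8.Prop5Unique lan) (p6 : B8.Prop6Printed d L B₁ c₁ cub)
    (p7 : B8SectGH.Prop7PrintedR fam toAxial) (t8 : B8Thm8Surviving.Thm8SurvivingAt 1 B₁ B₂ fam)
    (c₀ : ℝ) (hc₀ : 0 < c₀)
    (h165 : ∀ i α₀ α₁ (U₀ : (fam i).Cfg) (U' : (fam i).Pert), 0 < α₀ → α₀ ≤ c₀ →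
      (fam i).InA α₀ U₀ → (fam i).InAAx α₀ U₀ U' → (fam i).avgClose α₁ U₀ U' →
      (fam i).avgClose166 (11 * d ^ 2 * α₀ + α₁) U₀ U')
    (hginv : ∀ i α₀ (U₀ : (fam i).Cfg) (U' : (fam i).Pert) (u : (fam i).GT),
      (fam i).InAAx α₀ U₀ U' → (fam i).InAPair α₀ U₀ ((fam i).act U' u))
    (h137 : ∀ i α₁ b s (U₀ : (fam i).Cfg) (U' : (fam i).Pert) (u : (fam i).GT), (fam i).avgClose α₁ U₀ U' →
      (fam i).Restricted U₀ u → (fam i).C162 b s U₀ ((fam i).act U' u) → (fam i).C137 α₁ U₀ ((fam i).act U' u))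
    (h136_162 : ∀ i b b₂ s (U₀ : (fam i).Cfg) (U₁ : (fam i).Pert),
      (fam i).C136 b b₂ s U₀ U₁ → (fam i).C162 b s U₀ U₁)
    (hmono162 : ∀ i b s b' s' (U₀ : (fam i).Cfg) (U₁ : (fam i).Pert), b * s ≤ b' * s' →
      (fam i).C162 b s U₀ U₁ → (fam i).C162 b' s' U₀ U₁)
    (hmono137 : ∀ i α₁ α₁' (U₀ : (fam i).Cfg) (U₁ : (fam i).Pert), α₁ ≤ α₁' →
      (fam i).C137 α₁ U₀ U₁ → (fam i).C137 α₁' U₀ U₁) :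
    B8LeafRS d L C₂ B₁' B₀' B₁ B₂ c₁ inp B₀β loc fam lan cub toAxial where
  l1 := l1
  t2 := B8.thm2_of_thm4_prop3 d L C₂ B₁' inp B₀β (fun i => (fam i).toGFData2) hd hL hB₀β hC₂ hB₁' t4 p3 c₀ hc₀
    h165 hginv h137 h136_162 hmono162 hmono137
  p3 := p3
  t4 := t4
  p5e := p5e
  p5u := p5u
  p6 := p6
  p7 := p7
  t8 := t8

/-- **The knit of the re-typed leaf with Lemma 1 CONSUMED BY NAME** on the non-abelian block-pair carriers `B8Lemma1NonAbelian.blockPairNA d Lb 𝔸`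
(`DagDischargedII.lemma1Printed_blockPairNA`): SEVEN named printed hypotheses remain — `p3 t4 p5e p5u p6 p7 t8` (t8 surviving).
[cite: Balaban1985RegularSpaces, Lemma 1 (1.24)–(1.25) pp.79–80 (kernel version on the typed non-abelian block-pair carriers), Prop. 3 – Thm 8 pp.87–101 (named hypotheses; Thm 8 surviving)] -/
theorem b8LeafRS_knit_blockPairNA (Lb : ℕ) (𝔸 : Type) [NormedRing 𝔸] [NormOneClass 𝔸] [NormedAlgebra ℂ 𝔸] [CompleteSpace 𝔸]
    (hd : 1 ≤ d) (hL : 0 < L) (hB₀β : 0 < B₀β) (hC₂ : 0 ≤ C₂) (hB₁' : 5 * d * L * inp.B₀ ≤ B₁')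
    (p3 : B8.Prop3Printed d L C₂ inp B₀β (fun i => (fam i).toGFData2))
    (t4 : B8.Thm4Printed B₁' (fun i => (fam i).toGFData))
    (p5e : B8.Prop5Exists B₀' B₁ lan) (p5u : B8.Prop5Unique lan) (p6 : B8.Prop6Printed d L B₁ c₁ cub)
    (p7 : B8SectGH.Prop7PrintedR fam toAxial) (t8 : B8Thm8Surviving.Thm8SurvivingAt 1 B₁ B₂ fam)
    (c₀ : ℝ) (hc₀ : 0 < c₀)
    (h165 : ∀ i α₀ α₁ (U₀ : (fam i).Cfg) (U' : (fam i).Pert), 0 < α₀ → α₀ ≤ c₀ →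
      (fam i).InA α₀ U₀ → (fam i).InAAx α₀ U₀ U' → (fam i).avgClose α₁ U₀ U' →
      (fam i).avgClose166 (11 * d ^ 2 * α₀ + α₁) U₀ U')
    (hginv : ∀ i α₀ (U₀ : (fam i).Cfg) (U' : (fam i).Pert) (u : (fam i).GT),
      (fam i).InAAx α₀ U₀ U' → (fam i).InAPair α₀ U₀ ((fam i).act U' u))
    (h137 : ∀ i α₁ b s (U₀ : (fam i).Cfg) (U' : (fam i).Pert) (u : (fam i).GT), (fam i).avgClose α₁ U₀ U' →
      (fam i).Restricted U₀ u → (fam i).C162 b s U₀ ((fam i).act U' u) → (fam i).C137 α₁ U₀ ((fam i).act U' u))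
    (h136_162 : ∀ i b b₂ s (U₀ : (fam i).Cfg) (U₁ : (fam i).Pert),
      (fam i).C136 b b₂ s U₀ U₁ → (fam i).C162 b s U₀ U₁)
    (hmono162 : ∀ i b s b' s' (U₀ : (fam i).Cfg) (U₁ : (fam i).Pert), b * s ≤ b' * s' →
      (fam i).C162 b s U₀ U₁ → (fam i).C162 b' s' U₀ U₁)
    (hmono137 : ∀ i α₁ α₁' (U₀ : (fam i).Cfg) (U₁ : (fam i).Pert), α₁ ≤ α₁' →
      (fam i).C137 α₁ U₀ U₁ → (fam i).C137 α₁' U₀ U₁) :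
    B8LeafRS d L C₂ B₁' B₀' B₁ B₂ c₁ inp B₀β (B8Lemma1NonAbelian.blockPairNA d Lb 𝔸) fam lan cub toAxial :=
  b8LeafRS_knit hd hL hB₀β hC₂ hB₁' (lemma1Printed_blockPairNA d Lb 𝔸) p3 t4 p5e p5u p6 p7 t8 c₀ hc₀ h165 hginv h137 h136_162
    hmono162 hmono137

end Knit

/-! ## §4b The node at a run bound by the S-binding -/

section Node

variable {w : WorldP} {P : B12.RunParams} {X : PrintedCarriersR} {Y : PrintedCarriers9X} {Z : PrintedCarriers11} {V : PrintedCarriers14R}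
  {W : PrintedCarriers15}

/-- **N05 at a run bound by the S-binding, from the re-typed leaf over the run's B8 group** (in-edges discarded — the shape of N04's knit
and of `B8LeafKnit.b8_main_of_up`). [cite: Balaban1985RegularSpaces, Lemma 1 – Thm 8 pp.79–101 (node bookkeeping)] -/
theorem b8_main_of_upS (hup : w.up P = Upstream.ofPrintedAllXPNS X Y Z V W)
    (h : B8LeafRS X.d8 X.L8 X.C₂ X.B₁' X.B₀' X.B₁ X.B₂ X.c₁ X.inp8 X.B₀β X.loc8 X.fam8R X.lan8 X.cub8 X.toAxial8) :
    Dag.B8_main (leavesP w P) := by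
  refine b8_main_of_leaf w P ?_
  rw [hup]
  exact h

/-- **N05 at a run bound by the S-binding, KNIT from the run's own B8 data**: eight named printed statements over `X`'s B8 group with Theorem 8
in its surviving form (Theorem 2 derived, p. 88) + the (1.65) threshold + the six carrier laws + the constant side conditions — the
discharge-shaped statement of the node for the re-typed leaf, hypotheses DISPLAYED. [cite: Balaban1985RegularSpaces, Lemma 1 p.79, Prop. 3 p.87, Thm 4 p.88 with «Thm 4 ⇒ Thm 2» p.88, Prop. 5 p.94, Prop. 6 p.99, Prop. 7 p.100, Thm 8 p.101 surviving (named hypotheses; node bookkeeping)] -/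
theorem b8_main_of_upS_knit (hup : w.up P = Upstream.ofPrintedAllXPNS X Y Z V W)
    (hd : 1 ≤ X.d8) (hL : 0 < X.L8) (hB₀β : 0 < X.B₀β) (hC₂ : 0 ≤ X.C₂) (hB₁' : 5 * X.d8 * X.L8 * X.inp8.B₀ ≤ X.B₁')
    (l1 : B8.Lemma1Printed X.d8 X.loc8)
    (p3 : B8.Prop3Printed X.d8 X.L8 X.C₂ X.inp8 X.B₀β (fun i => (X.fam8R i).toGFData2))
    (t4 : B8.Thm4Printed X.B₁' (fun i => (X.fam8R i).toGFData))
    (p5e : B8.Prop5Exists X.B₀' X.B₁ X.lan8) (p5u : B8.Prop5Unique X.lan8) (p6 : B8.Prop6Printed X.d8 X.L8 X.B₁ X.c₁ X.cub8)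
    (p7 : B8SectGH.Prop7PrintedR X.fam8R X.toAxial8) (t8 : B8Thm8Surviving.Thm8SurvivingAt 1 X.B₁ X.B₂ X.fam8R)
    (c₀ : ℝ) (hc₀ : 0 < c₀)
    (h165 : ∀ i α₀ α₁ (U₀ : (X.fam8R i).Cfg) (U' : (X.fam8R i).Pert), 0 < α₀ → α₀ ≤ c₀ →
      (X.fam8R i).InA α₀ U₀ → (X.fam8R i).InAAx α₀ U₀ U' → (X.fam8R i).avgClose α₁ U₀ U' →
      (X.fam8R i).avgClose166 (11 * X.d8 ^ 2 * α₀ + α₁) U₀ U')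
    (hginv : ∀ i α₀ (U₀ : (X.fam8R i).Cfg) (U' : (X.fam8R i).Pert) (u : (X.fam8R i).GT),
      (X.fam8R i).InAAx α₀ U₀ U' → (X.fam8R i).InAPair α₀ U₀ ((X.fam8R i).act U' u))
    (h137 : ∀ i α₁ b s (U₀ : (X.fam8R i).Cfg) (U' : (X.fam8R i).Pert) (u : (X.fam8R i).GT), (X.fam8R i).avgClose α₁ U₀ U' →
      (X.fam8R i).Restricted U₀ u → (X.fam8R i).C162 b s U₀ ((X.fam8R i).act U' u) → (X.fam8R i).C137 α₁ U₀ ((X.fam8R i).act U' u))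
    (h136_162 : ∀ i b b₂ s (U₀ : (X.fam8R i).Cfg) (U₁ : (X.fam8R i).Pert),
      (X.fam8R i).C136 b b₂ s U₀ U₁ → (X.fam8R i).C162 b s U₀ U₁)
    (hmono162 : ∀ i b s b' s' (U₀ : (X.fam8R i).Cfg) (U₁ : (X.fam8R i).Pert), b * s ≤ b' * s' →
      (X.fam8R i).C162 b s U₀ U₁ → (X.fam8R i).C162 b' s' U₀ U₁)
    (hmono137 : ∀ i α₁ α₁' (U₀ : (X.fam8R i).Cfg) (U₁ : (X.fam8R i).Pert), α₁ ≤ α₁' →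
      (X.fam8R i).C137 α₁ U₀ U₁ → (X.fam8R i).C137 α₁' U₀ U₁) :
    Dag.B8_main (leavesP w P) :=
  b8_main_of_upS hup (b8LeafRS_knit hd hL hB₀β hC₂ hB₁' l1 p3 t4 p5e p5u p6 p7 t8 c₀ hc₀ h165 hginv h137 h136_162 hmono162 hmono137)

/-- **At an S-bound run whose `b8` leaf held AS TYPED under the old N-binding, N05 holds** (OLD ⇒ NEW at the node, under the carrier law).
[cite: Balaban1985RegularSpaces, Thm 8 p.101 (node bookkeeping)] -/
theorem b8_main_of_upS_of_b8LeafR (hup : w.up P = Upstream.ofPrintedAllXPNS X Y Z V W)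
    (h136_162 : ∀ i b b₂ s (U₀ : (X.fam8R i).Cfg) (U₁ : (X.fam8R i).Pert), (X.fam8R i).C136 b b₂ s U₀ U₁ → (X.fam8R i).C162 b s U₀ U₁)
    (h : B8LeafR X.d8 X.L8 X.C₂ X.B₁' X.B₀' X.B₁ X.B₂ X.c₁ X.inp8 X.B₀β X.loc8 X.fam8R X.lan8 X.cub8 X.toAxial8) :
    Dag.B8_main (leavesP w P) :=
  b8_main_of_upS hup (b8LeafRS_of_b8LeafR h136_162 h)

end Node

/-! ## §5 Hazards revisited: the Prop-7 half-space item (N0-6) is unchanged for the re-typed leaf -/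

section Hazards

/-- **The re-typed leaf is still FALSE over r05's half-space packaging** `B8Prop7HalfSpace.halfspaceGF 4 3 0 ℂ` with print's axial map —
through conjunct `p7` (`B8Prop7HalfSpace.not_prop7PrintedR_halfspace`), exactly as `B8LeafKnit.not_b8LeafR_halfspace`: re-typing `t8` does
not touch NODE 00 question N0-6 (family-of-record ∕ `p7` ruling). [cite: Balaban1985RegularSpaces, Prop. 7 (1.144)–(1.145) p.100 (the leaf's conjunct p7 on the half-space instances)] -/
theorem not_b8LeafRS_halfspace {I₁ I₃ I₄ : Type} (d : ℕ) (L C₂ B₁' B₀' B₁ B₂ c₁ : ℝ) (inp : B8.B9Inputs) (B₀β : ℝ)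
    (loc : I₁ → B8.LocalData) (lan : I₃ → B8.LandauData) (cub : I₄ → B8.CubeData) :
    ¬ B8LeafRS d L C₂ B₁' B₀' B₁ B₂ c₁ inp B₀β loc (B8Prop7HalfSpace.halfspaceGF 4 3 (0 : Fin 4) ℂ) lan cub
        (B8Prop7HalfSpace.toAxialHS 4 3 (by norm_num) (0 : Fin 4) ℂ) :=
  fun h => B8Prop7HalfSpace.not_prop7PrintedR_halfspace h.p7

end Hazards

end Literature.MathematicalPhysics.QuantumFieldTheory.Balaban1983to89.B8LeafKnitRS
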